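import Summits.QuantumAdvantage.QuantumAdvantage.Theorems.CubicForrelationNearExactIsExactFourteenLevelSix

/-!
# Level 6 × level 6 above `61/64` on 14 bits — preparatory lemmas (NearExactIsExact, disprover gen 24)

Negative/structural lemmas for the crux `CubicForrelation.NearExactIsExact` (item r2), finite slice `n = 14`.
HONEST FRAMING: elementary integer / counting facts used by `…Negative.LevelSixSixtyOneFourteen` — NOT summit progress.

* `lsp_chi_cases`, `lsp_chi_mul`: the mod-4 sign `χ(e) = 2 − (e mod 4) ∈ {±1}` of an odd integer, and
  `4 ∣ a+b+c+d ⇒ χ(d)χ(a) = χ(b)χ(c)` (the slack version of `fl_signs_of_four_dvd`: the four residuals need not be `±1`);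
* `lsp_cost_on`, `lsp_cost_off`: the distance from `e` to `χ(e)` (resp. to `0`) is paid for by the budget excess:
  `2|e − χ(e)| ≤ e² − 1` for odd `e`, `2|e| ≤ e²` for even `e`;
* `lsp_dirs`: two transversal directions `d₁, d₂` (with `d₁, d₂, d₁ ⊕ d₂` outside a subspace of size `≤ 2¹²`) whose twelve
  translates of four given points avoid a set of at most `511` "defects" (counting in `𝔽₂¹⁴`);
* `lsp_four_freq`: a transform with values in `{0, ±2¹²}` and energy `2²⁶` has exactly four non-zero frequencies;
* `lsp_W_diff_le`: `|Ŝ(y) − T̂(y)| ≤ Σ_x |S(x) − T(x)|` for integer-valued `S, T`.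

Sources: [this work] [folklore].  Standard axioms only.
-/

set_option linter.dupNamespace false -- D-0017: single-problem summit ⇒ `QuantumAdvantage.QuantumAdvantage` by design

noncomputable section

namespace Summit.QuantumAdvantage.QuantumAdvantage.Theorems.NearExactIsExact.Negative.LevelSixSixtyOnePrep

open Finset
open Literature.Computability.QuantumComplexity
open Literature.Computability.QuantumComplexity.BuzetChailloux (bxor zeroVec bxor_bxor_cancel_left bxor_zeroVec zeroVec_bxor
  bxor_comm bxor_self)
open Literature.Computability.QuantumComplexity.DerivativeWalsh (W)
open Summit.QuantumAdvantage.QuantumAdvantage.Theorems.CubicForrelation.NearExactIsExact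

variable {n : ℕ}

/-! ### The mod-4 sign of an odd integer -/

/-- The mod-4 sign `χ(e) = 2 − (e mod 4)` of an odd integer is `±1` and congruent to `e` modulo `4`. [folklore] -/
theorem lsp_chi_cases (e : ℤ) (he : Odd e) : (2 - e % 4 = 1 ∧ (4 : ℤ) ∣ e - 1) ∨ (2 - e % 4 = -1 ∧ (4 : ℤ) ∣ e + 1) := by
  obtain ⟨k, rfl⟩ := he
  omega

/-- **Four odd integers summing to a multiple of `4` have pairwise-consistent mod-4 signs**: `χ(d)χ(a) = χ(b)χ(c)`. [folklore] -/
theorem lsp_chi_mul {a b c d : ℤ} (ha : Odd a) (hb : Odd b) (hc : Odd c) (hd : Odd d) (h4 : (4 : ℤ) ∣ a + b + c + d) :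
    (2 - d % 4) * (2 - a % 4) = (2 - b % 4) * (2 - c % 4) := by
  rcases lsp_chi_cases a ha with ⟨ha1, ha2⟩ | ⟨ha1, ha2⟩ <;> rcases lsp_chi_cases b hb with ⟨hb1, hb2⟩ | ⟨hb1, hb2⟩ <;>
    rcases lsp_chi_cases c hc with ⟨hc1, hc2⟩ | ⟨hc1, hc2⟩ <;> rcases lsp_chi_cases d hd with ⟨hd1, hd2⟩ | ⟨hd1, hd2⟩ <;>
    rw [ha1, hb1, hc1, hd1] <;> norm_num <;> omega

/-- On the odd set the budget excess pays for the distance to the mod-4 sign: `2|e − χ(e)| ≤ e² − 1`. [folklore] -/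
theorem lsp_cost_on (e : ℤ) (he : Odd e) : 2 * |e - (2 - e % 4)| ≤ e ^ 2 - 1 := by
  rcases lsp_chi_cases e he with ⟨h1, h2⟩ | ⟨h1, h2⟩ <;> rw [h1] <;> obtain ⟨j, hj⟩ := h2
  · rw [hj]
    have hjj : |j| ≤ j ^ 2 := by rw [Int.abs_eq_natAbs]; exact Int.natAbs_le_self_sq j
    have he' : e = 4 * j + 1 := by omega
    rw [he', abs_mul, abs_of_pos (by norm_num : (0 : ℤ) < 4)]
    nlinarith [hjj, neg_abs_le j, le_abs_self j]
  · rw [show e - (-1 : ℤ) = e + 1 by ring, hj]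
    have hjj : |j| ≤ j ^ 2 := by rw [Int.abs_eq_natAbs]; exact Int.natAbs_le_self_sq j
    have he' : e = 4 * j - 1 := by omega
    rw [he', abs_mul, abs_of_pos (by norm_num : (0 : ℤ) < 4)]
    nlinarith [hjj, neg_abs_le j, le_abs_self j]

/-- Off the odd set the budget pays for the distance to `0`: `2|e| ≤ e²` for even `e`. [folklore] -/
theorem lsp_cost_off (e : ℤ) (he : ¬ Odd e) : 2 * |e| ≤ e ^ 2 := by
  rw [Int.not_odd_iff_even] at he
  obtain ⟨k, rfl⟩ := he
  have hkk : |k| ≤ k ^ 2 := by rw [Int.abs_eq_natAbs]; exact Int.natAbs_le_self_sq k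
  rw [show k + k = 2 * k by ring, abs_mul, abs_of_pos (by norm_num : (0 : ℤ) < 2)]
  nlinarith [hkk]

/-- A non-zero even integer has square at least `4`. [folklore] -/
theorem lsp_even_ne_zero_sq (e : ℤ) (he : ¬ Odd e) (hne : e ≠ 0) : 4 ≤ e ^ 2 := by
  rw [Int.not_odd_iff_even] at he
  obtain ⟨k, rfl⟩ := he
  have hk : k ≠ 0 := fun h => hne (by rw [h]; norm_num)
  rcases lt_or_gt_of_ne hk with h | h <;> nlinarith

/-! ### Transversal directions avoiding a small defect set -/

/-- **Transversal directions avoiding defects (14 bits).**  If `#V₀ ≤ 2¹²` and `#D ≤ 511`, then for any four points `p₀, …, p₃` there are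
`d₁, d₂` with `d₁, d₂, d₁ ⊕ d₂ ∉ V₀` such that the twelve translates `pᵢ ⊕ d₂`, `pᵢ ⊕ d₁`, `pᵢ ⊕ d₂ ⊕ d₁` avoid `D`
(`2·2¹² + 2·4·511 < 2¹⁴`). [folklore] -/
theorem lsp_dirs (V₀ D : Finset (Fin (7 + 7) → Bool)) (hV : #V₀ ≤ 4096) (hD : #D ≤ 511) (p₀ p₁ p₂ p₃ : Fin (7 + 7) → Bool) :
    ∃ d₁ d₂ : Fin (7 + 7) → Bool, d₁ ∉ V₀ ∧ d₂ ∉ V₀ ∧ bxor d₁ d₂ ∉ V₀ ∧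
      ∀ p ∈ ({p₀, p₁, p₂, p₃} : Finset (Fin (7 + 7) → Bool)),
        bxor p d₂ ∉ D ∧ bxor p d₁ ∉ D ∧ bxor (bxor p d₂) d₁ ∉ D := by
  classical
  set S : Finset (Fin (7 + 7) → Bool) := {p₀, p₁, p₂, p₃} with hSdef
  have hS : #S ≤ 4 := card_le_four
  have huniv : #(univ : Finset (Fin (7 + 7) → Bool)) = 16384 := by simp
  -- `Bad t` = the directions `d` for which some `p ⊕ d ⊕ t` is a defect
  set Bad : (Fin (7 + 7) → Bool) → Finset (Fin (7 + 7) → Bool) :=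
    fun t => S.biUnion fun p => D.image fun δ => bxor p (bxor δ t) with hBad
  have hBadcard : ∀ t, #(Bad t) ≤ 2044 := by
    intro t
    calc #(Bad t) ≤ ∑ p ∈ S, #(D.image fun δ => bxor p (bxor δ t)) := card_biUnion_le
      _ ≤ ∑ p ∈ S, #D := sum_le_sum fun p _ => card_image_le
      _ = #S * #D := by rw [sum_const, smul_eq_mul]
      _ ≤ 4 * 511 := Nat.mul_le_mul hS hD
  have hgood : ∀ t d, d ∉ Bad t → ∀ p ∈ S, bxor (bxor p d) t ∉ D := by
    intro t d hd p hp hmem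
    apply hd
    refine mem_biUnion.2 ⟨p, hp, mem_image.2 ⟨bxor (bxor p d) t, hmem, ?_⟩⟩
    rw [iw_bxor_assoc (bxor p d) t t, bxor_self, bxor_zeroVec, bxor_bxor_cancel_left]
  -- the first direction
  have h1 : #(V₀ ∪ Bad zeroVec) < #(univ : Finset (Fin (7 + 7) → Bool)) := by
    rw [huniv]
    calc #(V₀ ∪ Bad zeroVec) ≤ #V₀ + #(Bad zeroVec) := card_union_le _ _
      _ ≤ 4096 + 2044 := Nat.add_le_add hV (hBadcard _)
      _ < 16384 := by norm_num
  obtain ⟨d₁, -, hd₁⟩ := exists_mem_notMem_of_card_lt_card h1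
  rw [mem_union, not_or] at hd₁
  -- the second direction
  have h2 : #(((V₀ ∪ V₀.image (bxor d₁)) ∪ Bad zeroVec) ∪ Bad d₁) < #(univ : Finset (Fin (7 + 7) → Bool)) := by
    rw [huniv]
    calc #(((V₀ ∪ V₀.image (bxor d₁)) ∪ Bad zeroVec) ∪ Bad d₁)
        ≤ #((V₀ ∪ V₀.image (bxor d₁)) ∪ Bad zeroVec) + #(Bad d₁) := card_union_le _ _
      _ ≤ (#(V₀ ∪ V₀.image (bxor d₁)) + #(Bad zeroVec)) + #(Bad d₁) := Nat.add_le_add_right (card_union_le _ _) _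
      _ ≤ ((#V₀ + #(V₀.image (bxor d₁))) + #(Bad zeroVec)) + #(Bad d₁) :=
          Nat.add_le_add_right (Nat.add_le_add_right (card_union_le _ _) _) _
      _ ≤ ((4096 + 4096) + 2044) + 2044 :=
          Nat.add_le_add (Nat.add_le_add (Nat.add_le_add hV (card_image_le.trans hV)) (hBadcard _)) (hBadcard _)
      _ < 16384 := by norm_num
  obtain ⟨d₂, -, hd₂⟩ := exists_mem_notMem_of_card_lt_card h2
  simp only [mem_union, not_or] at hd₂
  obtain ⟨⟨⟨hd₂V, hd₂img⟩, hd₂B0⟩, hd₂B1⟩ := hd₂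
  refine ⟨d₁, d₂, hd₁.1, hd₂V, fun h => hd₂img (mem_image.2 ⟨bxor d₁ d₂, h, bxor_bxor_cancel_left d₁ d₂⟩), ?_⟩
  intro p hp
  refine ⟨?_, ?_, hgood d₁ d₂ hd₂B1 p hp⟩
  · have h := hgood zeroVec d₂ hd₂B0 p hp
    rwa [bxor_zeroVec] at h
  · have h := hgood zeroVec d₁ hd₁.2 p hp
    rwa [bxor_zeroVec] at h

/-! ### Exactly four frequencies -/

/-- **Four frequencies.**  A transform on `14` bits with values in `{0, ±2¹²}` and `Σ T² = 2¹⁴·2¹²` is non-zero at exactly four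
points. [folklore] -/
theorem lsp_four_freq (T : (Fin (7 + 7) → Bool) → ℝ) (hT : ∀ y, T y = 0 ∨ T y = 4096 ∨ T y = -4096)
    (hP : ∑ y, T y ^ 2 = (2 : ℝ) ^ (7 + 7) * 4096) : #(univ.filter fun y => T y ≠ 0) = 4 := by
  classical
  have hsq : ∀ y, T y ^ 2 = if T y ≠ 0 then (16777216 : ℝ) else 0 := by
    intro y
    rcases hT y with h | h | h <;> rw [h] <;> norm_num
  rw [sum_congr rfl fun y _ => hsq y, ← sum_filter, sum_const, nsmul_eq_mul] at hP
  have h : (#(univ.filter fun y => T y ≠ 0) : ℝ) = 4 := by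
    norm_num at hP
    linarith
  exact_mod_cast h

/-! ### Transforms of nearby integer functions -/

/-- **`|Ŝ(y) − T̂(y)| ≤ Σ_x |S(x) − T(x)|`** for integer-valued `S, T` (each character has modulus `1`). [folklore] -/
theorem lsp_W_diff_le (S T : (Fin n → Bool) → ℤ) (y : Fin n → Bool) :
    |W (fun x => ((S x : ℤ) : ℝ)) y - W (fun x => ((T x : ℤ) : ℝ)) y| ≤ ((∑ x, |S x - T x| : ℤ) : ℝ) := by
  unfold W
  rw [← sum_sub_distrib]
  have e : ∀ x, (S x : ℝ) * twist x y - (T x : ℝ) * twist x y = ((S x - T x : ℤ) : ℝ) * twist x y := by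
    intro x; push_cast; ring
  rw [sum_congr rfl fun x _ => e x]
  push_cast
  refine (abs_sum_le_sum_abs _ _).trans (sum_le_sum fun x _ => ?_)
  rw [abs_mul]
  rcases Simon.twist_eq_one_or x y with h | h <;> rw [h] <;> simp

end Summit.QuantumAdvantage.QuantumAdvantage.Theorems.NearExactIsExact.Negative.LevelSixSixtyOnePrep

end
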